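import Summits.AnomalousDissipation.AnomalousDissipation.Theorems.SolenoidalFractalHomogenisationLagrangianStepSidebandXEffGenDefs
import Summits.AnomalousDissipation.AnomalousDissipation.Theorems.SolenoidalFractalHomogenisationLagrangianStepCellLawVEffectiveGenerator
import Literature.Analysis.ODE.LinearPeriodicAveraging
import Literature.Analysis.FluidPDE.PassiveVectorTensorFourier
import Mathlib.Analysis.Calculus.Deriv.MeanValue
import HarnessLib

/-!
# K1L_D `LagrangianRenormalisationStepDesign` (stmt-AnomalousDissipation-27980), `stub_D1_V0R` (D27-1; V0 = clause (ii) of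
# `WCrossing.D1ExactFamily`), brick T7c: THE AVERAGED FLOW `exp(−t·effGenC 𝔹 ℓ r₁)` ON COMPLEXIFIED TRANSVERSAL REAL VECTORS IS THE EFFECTIVE SOLUTION'S
# SLOW MODE `exp(−t·effGen 𝔹 ℓ)` (helper; `--kind proof --supports stmt-AnomalousDissipation-27980 --as helper`)

Summits-side helper file of route `SolenoidalFractalHomogenisation` (prover seat `ad-k1l-cellLawV-w1` g7; 0 sorry, no defs, no named facts).  Brick T7c of the
V0 memo `Cruxes/LagrangianRenormalisationStepDesign/Lines/onelevel-V0-residual.md` §4: the averaging estimate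
`…SidebandXSlowAveraging(Weighted).norm_modeRep_sub_exp_le(_weighted)` compares the slow mode with `exp(−t·Ḡ)(x 0)` in `ℂ³`, `Ḡ = effGenC 𝔹 ℓ r₁`
(`…SidebandXEffGenDefs`), while the effective solution's slow mode is `exp(−t·effGen 𝔹 ℓ) (p/2)` in `ℝ³` (`…CellLawVEffectiveMode.effective_modeCoeff_eq`,
`effGen 𝔹 ℓ = 4π² P Σ(𝔹,ℓ) P`, `…CellLawVEffectiveGenerator`).  Here: for `p ⊥ ℓ` (`ℓ ≠ 0`) and `t ≥ 0`,
`exp(−t·effGenC 𝔹 ℓ r₁) (p/2)ᶜ = (exp(−t·effGen 𝔹 ℓ) (p/2))ᶜ` (`ᶜ` = coordinatewise complexification) — by uniqueness for `z' = −Ḡz`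
(`Literature…PeriodicAveraging.eq_exp_neg_smul_apply`): the complexified effective mode solves that equation because `effGenC` acts on complexified
transversal real vectors as `effGen` (coordinate dictionary `P_ℓ uᶜ = (P_{ℓ̂} u)ᶜ`, `T_{𝔹ᵀ}(ℓ) uᶜ = (Σ(𝔹,ℓ) u)ᶜ`) and the effective mode stays transversal.
* `transversalProj_realVec`, `symbT_majorTranspose_realVec`, `projPerp_mulVec_of_transversal`, `sum_kvec_mul_effGen_mulVec`, **`effGenC_realVec`**;
* `transversal_exp_effGen_mulVec` — `ℓ · (exp(−s·effGen)(p/2)) = 0`; **`exp_effGenC_realVec_eq`** — the identification above.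
NOT a proof of any registered stub, of K1L_D, or of anomalous dissipation; rung F-D1.A0 infrastructure.
-/

set_option linter.dupNamespace false

noncomputable section

namespace Summit.AnomalousDissipation.AnomalousDissipation.Theorems.SolenoidalFractalHomogenisation.LagrangianStep.Sideband

open Set MeasureTheory Complex UnitAddTorus NormedSpace
open scoped InnerProductSpace
open Literature.Analysis Literature.Analysis.FunctionSpaces Literature.Analysis.FunctionSpaces.Torus
open Literature.Analysis.FluidPDE Literature.Analysis.FluidPDE.Torus Literature.Analysis.FluidPDE.LatticeShear
open Literature.Analysis.ODE.PeriodicAveraging (eq_exp_neg_smul_apply hasDerivAt_exp_neg_smul_mulVec)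
open Summit.AnomalousDissipation.AnomalousDissipation.Theorems.SolenoidalFractalHomogenisation.LagrangianStep
  (effGen kvec khat projPerp sigMat sum_kvec_mul_projPerp_col)

/-! ## §1 Coordinate dictionary: `ℂ³`-operators on complexified real vectors -/

/-- Coordinates of a complexified real vector. [folklore] -/
theorem realVec_apply (y : Fin 3 → ℝ) (i : Fin 3) :
    (WithLp.toLp 2 (fun i => ((y i : ℝ) : ℂ)) : EuclideanSpace ℂ (Fin 3)) i = ((y i : ℝ) : ℂ) := rfl

/-- `ℓ · uᶜ = (Σⱼ ℓⱼ uⱼ : ℝ)`. [cite: Temam1984, Ch. III §1.1] -/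
theorem kdot_realVec (ℓ : Fin 3 → ℤ) (y : Fin 3 → ℝ) :
    kdot ℓ (WithLp.toLp 2 (fun i => ((y i : ℝ) : ℂ)) : EuclideanSpace ℂ (Fin 3)) = ((∑ j, (ℓ j : ℝ) * y j : ℝ) : ℂ) := by
  rw [kdot_apply]; push_cast; rfl

/-- `|ℓ|² = ‖latticeVec ℓ‖²`. [folklore] -/
theorem freqNormSq_eq_norm_latticeVec_sq (ℓ : Fin 3 → ℤ) : freqNormSq ℓ = ‖Torus.latticeVec ℓ‖ ^ 2 := by
  rw [EuclideanSpace.real_norm_sq_eq, freqNormSq]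
  exact Finset.sum_congr rfl fun a _ => by rw [Torus.latticeVec_apply]

/-- Coordinates of `P_{ℓ̂} u`: `(P_{ℓ̂} u)ᵢ = uᵢ − ℓᵢ (Σⱼ ℓⱼ uⱼ)/|ℓ|²` (`ℓ ≠ 0`). [cite: Temam1984, Ch. III §1.1] -/
theorem projPerp_khat_mulVec_apply {ℓ : Fin 3 → ℤ} (hℓ : ℓ ≠ 0) (u : Fin 3 → ℝ) (i : Fin 3) :
    (projPerp (khat ℓ)).mulVec u i = u i - (ℓ i : ℝ) * (∑ j, (ℓ j : ℝ) * u j) / freqNormSq ℓ := by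
  have hpos : 0 < ‖Torus.latticeVec ℓ‖ := norm_latticeVec_pos_of_ne_zero hℓ
  simp only [Matrix.mulVec, dotProduct, projPerp, khat, sub_mul, ite_mul, one_mul, zero_mul, Finset.sum_sub_distrib,
    Finset.sum_ite_eq, Finset.mem_univ, if_true]
  rw [freqNormSq_eq_norm_latticeVec_sq]
  have h : ∀ x, (ℓ i : ℝ) / ‖Torus.latticeVec ℓ‖ * ((ℓ x : ℝ) / ‖Torus.latticeVec ℓ‖) * u x =
      (ℓ i : ℝ) * ((ℓ x : ℝ) * u x) / ‖Torus.latticeVec ℓ‖ ^ 2 := fun x => by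
    field_simp
  simp_rw [h]
  rw [← Finset.sum_div, ← Finset.mul_sum]

/-- **`P_ℓ uᶜ = (P_{ℓ̂} u)ᶜ`** (`ℓ ≠ 0`). [cite: Temam1984, Ch. III §1.1] -/
theorem transversalProj_realVec {ℓ : Fin 3 → ℤ} (hℓ : ℓ ≠ 0) (u : Fin 3 → ℝ) :
    transversalProj ℓ (WithLp.toLp 2 (fun i => ((u i : ℝ) : ℂ)) : EuclideanSpace ℂ (Fin 3)) =
      WithLp.toLp 2 (fun i => (((projPerp (khat ℓ)).mulVec u i : ℝ) : ℂ)) := by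
  have hF : (freqNormSq ℓ : ℂ) ≠ 0 := by exact_mod_cast (freqNormSq_pos_of_ne_zero' hℓ).ne'
  ext i
  rw [transversalProj_apply, kdot_realVec, PiLp.sub_apply, PiLp.smul_apply, waveVecC_apply, realVec_apply, realVec_apply, smul_eq_mul,
    projPerp_khat_mulVec_apply hℓ]
  push_cast
  field_simp

/-- **`T_{𝔹ᵀ}(ℓ) uᶜ = (Σ(𝔹, ℓ) u)ᶜ`** (`Σ(𝔹,ℓ)_{ij} = Σ_{ab} 𝔹 i a j b ℓ_a ℓ_b`). [cite: Frisch1995Turbulence, §9.6.3 eq. (9.57) p. 233] -/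
theorem symbT_majorTranspose_realVec (𝔹 : Torus.Visc4 (Fin 3)) (ℓ : Fin 3 → ℤ) (u : Fin 3 → ℝ) :
    Torus.symbT (Torus.majorTranspose 𝔹) ℓ (WithLp.toLp 2 (fun i => ((u i : ℝ) : ℂ)) : EuclideanSpace ℂ (Fin 3)) =
      WithLp.toLp 2 (fun i => (((sigMat 𝔹 (kvec ℓ)).mulVec u i : ℝ) : ℂ)) := by
  ext j
  rw [Torus.symbT_apply, realVec_apply]
  simp only [Matrix.mulVec, dotProduct, sigMat, kvec, Torus.majorTranspose]
  push_cast
  simp only [Finset.sum_mul]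
  refine Finset.sum_congr rfl fun i _ => ?_
  rw [Finset.sum_comm]
  refine Finset.sum_congr rfl fun a _ => Finset.sum_congr rfl fun b _ => ?_
  ring

/-- `Σⱼ ℓⱼ (P_{ℓ̂} w)ⱼ = 0` (`ℓ ≠ 0`). [cite: Temam1984, Ch. III §1.1] -/
theorem sum_kvec_mul_projPerp_mulVec {ℓ : Fin 3 → ℤ} (hℓ : ℓ ≠ 0) (w : Fin 3 → ℝ) :
    ∑ j, (ℓ j : ℝ) * (projPerp (khat ℓ)).mulVec w j = 0 := by
  simp only [Matrix.mulVec, dotProduct, Finset.mul_sum]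
  rw [Finset.sum_comm]
  refine Finset.sum_eq_zero fun i _ => ?_
  have h := sum_kvec_mul_projPerp_col hℓ i
  calc ∑ j, (ℓ j : ℝ) * (projPerp (khat ℓ) j i * w i) = (∑ j, (ℓ j : ℝ) * projPerp (khat ℓ) j i) * w i := by
        rw [Finset.sum_mul]; exact Finset.sum_congr rfl fun j _ => by ring
    _ = 0 := by rw [h, zero_mul]

/-- `Σⱼ ℓⱼ (effGen 𝔹 ℓ w)ⱼ = 0` (`ℓ ≠ 0`): the effective generator maps into the transversal plane. [cite: Temam1984, Ch. III §1.1] -/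
theorem sum_kvec_mul_effGen_mulVec (𝔹 : Torus.Visc4 (Fin 3)) {ℓ : Fin 3 → ℤ} (hℓ : ℓ ≠ 0) (w : Fin 3 → ℝ) :
    ∑ j, (ℓ j : ℝ) * (effGen 𝔹 ℓ).mulVec w j = 0 := by
  unfold effGen
  rw [Matrix.smul_mulVec, Matrix.mul_assoc, ← Matrix.mulVec_mulVec]
  simp only [Pi.smul_apply, smul_eq_mul]
  calc ∑ j, (ℓ j : ℝ) * (4 * Real.pi ^ 2 * (projPerp (khat ℓ)).mulVec ((sigMat 𝔹 (kvec ℓ) * projPerp (khat ℓ)).mulVec w) j)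
      = 4 * Real.pi ^ 2 * ∑ j, (ℓ j : ℝ) * (projPerp (khat ℓ)).mulVec ((sigMat 𝔹 (kvec ℓ) * projPerp (khat ℓ)).mulVec w) j := by
        rw [Finset.mul_sum]; exact Finset.sum_congr rfl fun j _ => by ring
    _ = 0 := by rw [sum_kvec_mul_projPerp_mulVec hℓ, mul_zero]

/-- `P_{ℓ̂} u = u` for transversal `u`. [cite: Temam1984, Ch. III §1.1] -/
theorem projPerp_mulVec_of_transversal {ℓ : Fin 3 → ℤ} {u : Fin 3 → ℝ} (hu : ∑ j, (ℓ j : ℝ) * u j = 0) :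
    (projPerp (khat ℓ)).mulVec u = u := by
  funext i
  simp only [Matrix.mulVec, dotProduct, projPerp, khat, sub_mul, ite_mul, one_mul, zero_mul, Finset.sum_sub_distrib,
    Finset.sum_ite_eq, Finset.mem_univ, if_true]
  have h : ∑ x, (ℓ i : ℝ) / ‖Torus.latticeVec ℓ‖ * ((ℓ x : ℝ) / ‖Torus.latticeVec ℓ‖) * u x =
      (ℓ i : ℝ) / ‖Torus.latticeVec ℓ‖ ^ 2 * ∑ x, (ℓ x : ℝ) * u x := by
    rw [Finset.mul_sum]; exact Finset.sum_congr rfl fun x _ => by ring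
  rw [h, hu, mul_zero, sub_zero]

/-- **`effGenC 𝔹 ℓ r₁ uᶜ = (effGen 𝔹 ℓ u)ᶜ` for TRANSVERSAL real `u`** (`ℓ ≠ 0`; the augmentation is idle). [cite: MajdaKramer1999, §2.2.1.3 (55)] -/
theorem effGenC_realVec (𝔹 : Torus.Visc4 (Fin 3)) {ℓ : Fin 3 → ℤ} (hℓ : ℓ ≠ 0) (r₁ : ℝ) {u : Fin 3 → ℝ} (hu : ∑ j, (ℓ j : ℝ) * u j = 0) :
    effGenC 𝔹 ℓ r₁ (WithLp.toLp 2 (fun i => ((u i : ℝ) : ℂ)) : EuclideanSpace ℂ (Fin 3)) =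
      WithLp.toLp 2 (fun i => (((effGen 𝔹 ℓ).mulVec u i : ℝ) : ℂ)) := by
  have hP : transversalProj ℓ (WithLp.toLp 2 (fun i => ((u i : ℝ) : ℂ)) : EuclideanSpace ℂ (Fin 3)) = WithLp.toLp 2 (fun i => ((u i : ℝ) : ℂ)) := by
    rw [transversalProj_realVec hℓ, projPerp_mulVec_of_transversal hu]
  rw [effGenC_apply, hP, sub_self, smul_zero, add_zero, Torus.modalAdjGen_apply, symbT_majorTranspose_realVec, transversalProj_realVec hℓ]
  unfold effGen
  rw [Matrix.smul_mulVec, Matrix.mul_assoc, ← Matrix.mulVec_mulVec, ← Matrix.mulVec_mulVec, projPerp_mulVec_of_transversal hu]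
  ext i
  rw [PiLp.smul_apply, realVec_apply, realVec_apply, Pi.smul_apply, smul_eq_mul, smul_eq_mul]
  push_cast
  ring

/-! ## §2 The effective mode stays transversal and solves the averaged equation in `ℂ³` -/

/-- **The effective slow mode stays transversal**: `Σⱼ ℓⱼ (exp(−s·effGen 𝔹 ℓ) v)ⱼ = 0` for transversal `v` (`ℓ ≠ 0`).
[cite: Hale1980, Ch. III §1, Theorem 1.1] -/
theorem transversal_exp_effGen_mulVec (𝔹 : Torus.Visc4 (Fin 3)) {ℓ : Fin 3 → ℤ} (hℓ : ℓ ≠ 0) {v : Fin 3 → ℝ}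
    (hv : ∑ j, (ℓ j : ℝ) * v j = 0) (s : ℝ) :
    ∑ j, (ℓ j : ℝ) * (exp (-(s • effGen 𝔹 ℓ))).mulVec v j = 0 := by
  -- `φ(s) = ℓ · X(s)` has zero derivative and `φ(0) = 0`
  have hd : ∀ u, HasDerivAt (fun u : ℝ => ∑ j, (ℓ j : ℝ) * (exp (-(u • effGen 𝔹 ℓ))).mulVec v j) 0 u := by
    intro u
    have hX := hasDerivAt_exp_neg_smul_mulVec (effGen 𝔹 ℓ) v u
    have h := HasDerivAt.fun_sum fun j (_ : j ∈ Finset.univ) => ((hasDerivAt_pi.1 hX j).const_mul (ℓ j : ℝ))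
    have h0 : ∑ j ∈ Finset.univ, (ℓ j : ℝ) * (-((effGen 𝔹 ℓ).mulVec ((exp (-(u • effGen 𝔹 ℓ))).mulVec v))) j = 0 := by
      simp only [Pi.neg_apply, mul_neg, Finset.sum_neg_distrib, neg_eq_zero]
      exact sum_kvec_mul_effGen_mulVec 𝔹 hℓ _
    rw [h0] at h
    exact h
  have hconst := is_const_of_deriv_eq_zero (fun u => (hd u).differentiableAt) (fun u => (hd u).deriv) s 0
  rw [hconst]
  simp [hv]

/-- **THE AVERAGED FLOW ON COMPLEXIFIED TRANSVERSAL VECTORS IS THE EFFECTIVE MODE**: for `Σⱼ ℓⱼ vⱼ = 0` (`ℓ ≠ 0`) and `t ≥ 0`,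
`exp(−t·effGenC 𝔹 ℓ r₁) vᶜ = (exp(−t·effGen 𝔹 ℓ) v)ᶜ`. [cite: Hale1980, Ch. III §1, Theorem 1.1 (homogeneous case)]
[cite: SandersVerhulstMurdock2007, Theorem 2.8.1 (averaged equation)] -/
theorem exp_effGenC_realVec_eq (𝔹 : Torus.Visc4 (Fin 3)) {ℓ : Fin 3 → ℤ} (hℓ : ℓ ≠ 0) (r₁ : ℝ) {v : Fin 3 → ℝ}
    (hv : ∑ j, (ℓ j : ℝ) * v j = 0) {t : ℝ} (ht : 0 ≤ t) :
    exp (-(t • effGenC 𝔹 ℓ r₁)) (WithLp.toLp 2 (fun i => ((v i : ℝ) : ℂ)) : EuclideanSpace ℂ (Fin 3)) =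
      WithLp.toLp 2 (fun i => (((exp (-(t • effGen 𝔹 ℓ))).mulVec v i : ℝ) : ℂ)) := by
  -- the complexification as a continuous linear map `(Fin 3 → ℝ) →L[ℝ] ℂ³`
  let Φ : (Fin 3 → ℝ) →L[ℝ] EuclideanSpace ℂ (Fin 3) :=
    (FunctionSpaces.EuclideanSpace.complexify (ι := Fin 3)).toContinuousLinearMap.comp
      ((PiLp.continuousLinearEquiv 2 ℝ (fun _ : Fin 3 => ℝ)).symm : (Fin 3 → ℝ) →L[ℝ] EuclideanSpace ℝ (Fin 3))
  have hΦ : ∀ u, Φ u = WithLp.toLp 2 (fun i => ((u i : ℝ) : ℂ)) := fun u => by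
    ext i
    simp only [Φ, ContinuousLinearMap.comp_apply, LinearIsometry.coe_toContinuousLinearMap, FunctionSpaces.EuclideanSpace.complexify_apply]
    rfl
  -- the complexified effective mode solves `z' = −effGenC z`
  set z : ℝ → EuclideanSpace ℂ (Fin 3) := fun s => WithLp.toLp 2 (fun i => (((exp (-(s • effGen 𝔹 ℓ))).mulVec v i : ℝ) : ℂ)) with hz
  have hzd : ∀ s ∈ Icc 0 t, HasDerivAt z (-(effGenC 𝔹 ℓ r₁ (z s))) s := by
    intro s _
    have hX := hasDerivAt_exp_neg_smul_mulVec (effGen 𝔹 ℓ) v s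
    have h := Φ.hasFDerivAt.comp_hasDerivAt s hX
    have hfun : (Φ ∘ fun u : ℝ => (exp (-(u • effGen 𝔹 ℓ))).mulVec v) = z := by funext u; rfl
    rw [hfun, hΦ] at h
    have hval : WithLp.toLp 2 (fun i => (((-((effGen 𝔹 ℓ).mulVec ((exp (-(s • effGen 𝔹 ℓ))).mulVec v))) i : ℝ) : ℂ)) =
        -(effGenC 𝔹 ℓ r₁ (z s)) := by
      rw [hz, effGenC_realVec 𝔹 hℓ r₁ (transversal_exp_effGen_mulVec 𝔹 hℓ hv s)]
      ext i; simp
    rw [hval] at h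
    exact h
  have hmain := eq_exp_neg_smul_apply (effGenC 𝔹 ℓ r₁) z ht hzd
  have hz0 : z 0 = WithLp.toLp 2 (fun i => ((v i : ℝ) : ℂ)) := by
    rw [hz]; ext i; simp
  rw [hz0] at hmain
  exact hmain.symm

end Summit.AnomalousDissipation.AnomalousDissipation.Theorems.SolenoidalFractalHomogenisation.LagrangianStep.Sideband

end
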